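import Summits.AtomisticToContinuum.HydrodynamicLimit.Theorems.CollisionIsometryCLTAdaptedWeightCLTBHEntropyBudgetRate
import Summits.AtomisticToContinuum.HydrodynamicLimit.Theorems.CollisionIsometryCLTAdaptedWeightCLTBHEntropyBudgetIdentity
import Summits.AtomisticToContinuum.HydrodynamicLimit.Theorems.CollisionIsometryCLTAdaptedWeightCLTCBTailsVmax

/-!
# Entropy budget (stub `stub_entropyBudget`, line `block-h-dissipation-closure`, crux `AdaptedWeightCLT`,
stmt-AtomisticToContinuum-14868; `--supports`) — the EXACT IDENTITY on good orbits and the decomposed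
budget MODULO THE BREGMAN SUM

* **The identity (mechanism (i)).** For an admissible cell-kernel family, `h > 0`, `0 < δ ≤ 1`, `0 < σ < 1/2`,
  every hard-sphere flow `Φ`, `t ≥ 0` and `z ∈ Φ.good`:
  `realDiss = S_N(Φ_0 z) − S_N(Φ_t z) + transS + bregS` (`budget_identity`): the realised first-order
  dissipation and the Bregman sum differ, collision by collision, by the exact jump `S_N(pre) − S_N(post)`
  (`collisionPairSum_add`), and the jumps telescope against the transport integral along the trajectory
  (helper 12, fed with the flight-differentiability of `S_N`, helper 11).
* **The budget modulo the Bregman sum.** Given moreover H2 (`TailsOn`) and the SMALLNESS OF THE BREGMAN SUM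
  (`∀ p > 0, P_N{(N+1)^{γc+p} < bregS} → 0`, written inline), `BudgetDecompOn` holds
  (`budgetDecomp_of_bregSmall`): on the good set (conull for the local Gibbs law) the identity holds, and its
  right side is `O_P((N+1)^{γc+p})` — `|S_N| ≤ C(h,δ) + π KE/(N+1)` (helper 3) with the energy conserved and
  `O_P(1)` by H2 (`sum_sq_le_of_tails`); `|transS| ≤ K (N+1)^{γc} ∫₀ᵗ (1+v_max)⁸` (helper 11) with
  `∫₀ᵗ (1+v_max)⁸ = O_P((N+1)^{p/2})` by H2 (`stub_tailsVmax`); and the Bregman sum by hypothesis.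
* **Why the Bregman sum is a separate input** (the registered `stub_entropyBudget` asks to bound it from
  `FewCollisionsOn` + H2): each Bregman term is `≥ 0` and of size `(N+1)⁻¹ · u_c`, `u_c ≈ α h⁻³/f̂_pre` at the
  moved velocity bumps — `O((m_cell h³δ)⁻¹)` for bumps landing in the bulk of the cell law, but up to
  `O(log N + |v|²/h²)` for LONELY ones (only the floor `δM` present); `FewCollisionsOn` allows `(N+1)^{4/3+p}`
  contacts and nothing in H2 + energy conservation + the collision count bounds the number of lonely contacts
  by `(N+1)^{1+γc}` (a velocity-space covering census bounds lonely PARTICLES per cell, not their contact RATE).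
  The downstream composition uses only `realDiss ≤ (N+1)^{γc+p}` (`budgetOn_of_decomp`), and
  `−incr = (S_N(pre) − S_N(post)) + Bregman ≥ S_N(pre) − S_N(post)`, so an upper bound on the Bregman sum is
  genuinely needed: it is the line's shared soft spot (the same lonely-contact remainders appear in S2).
-/

namespace Summit.AtomisticToContinuum.HydrodynamicLimit.Theorems.BlockHDissipation

open scoped BigOperators Topology Classical MeasureTheory ENNReal InnerProductSpace
open Filter Set MeasureTheory
open Literature.Analysis.FluidPDE
open Summit.AtomisticToContinuum.HydrodynamicLimit.Theorems.ContactSourceDuhamel (T3 V3 Cfg Vel Flow Flows)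
open Summit.AtomisticToContinuum.HydrodynamicLimit.Theorems.ContactSourceDuhamel.TimeLocal
open Summit.AtomisticToContinuum.HydrodynamicLimit.Theorems.ContactBalance (vmax vmaxInt stub_tailsVmax
  PathwiseBudget.continuous_vmax PathwiseBudget.vmax_flow_le TailsVmax.vmax_nonneg)
open Literature.MathematicalPhysics.KineticTheory (hsDiameter localGibbsLaw localGibbsLaw_absolutelyContinuous)

noncomputable section

namespace EntropyBudget

variable {σ : ℝ} {N : ℕ} {ψ : ℕ → T3 → ℝ} {h δ : ℝ}

/-! ## The exact identity on good orbits -/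

/-- **THE EXACT TELESCOPING IDENTITY (mechanism (i) of `stub_entropyBudget`).** On a good orbit,
`realDiss = S_N(Φ_0 z) − S_N(Φ_t z) + transS + bregS`. -/
theorem budget_identity {γc C' : ℝ} (hadm : AdmissibleKernel γc C' ψ) (hh : 0 < h) (hδ : 0 < δ) (hδ1 : δ ≤ 1)
    (hσ : 0 < σ) (hσ2 : σ < 2⁻¹) (Φ : Flow σ N) {t : ℝ} (ht : 0 ≤ t) {z : Cfg N} (hz : z ∈ Φ.good) :
    realDiss σ N Φ ψ h δ t z = entS N ψ h δ (Φ.flow 0 z) - entS N ψ h δ (Φ.flow t z) +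
      transS σ N Φ ψ h δ t z + bregS σ N Φ ψ h δ t z := by
  have htraj := Φ.isTrajectory z hz
  set E : Cfg N → ℝ := fun w => entS N ψ h δ w with hE
  have hEd : ∀ (w : Cfg N) (r : ℝ), DifferentiableAt ℝ (fun s => E (freeFlight (Torus.geometry (Fin 3)) s w)) r :=
    fun w r => differentiableAt_entS_flight hadm hh hδ hδ1 N w r
  have hEb : ∀ w : Cfg N, ∃ B : ℝ, ∀ r, |deriv (fun s => E (freeFlight (Torus.geometry (Fin 3)) s w)) r| ≤ B :=
    fun w => exists_deriv_entS_bound hadm hh hδ hδ1 N w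
  -- the jump summand and the telescoping
  set g : ℝ → Fin (N + 1) → Fin (N + 1) → ℝ := fun s i j =>
    if i < j then E (collidePair (Torus.geometry (Fin 3)) i j (Φ.flow s z)) - E (Φ.flow s z) else 0 with hg
  have hjump : ∀ s ∈ collisionTimes (Torus.geometry (Fin 3)) (hsDiameter σ N) (fun s => Φ.flow s z),
      ∑ p ∈ contactPairs (Torus.geometry (Fin 3)) (hsDiameter σ N) (Φ.flow s z), g s p.1 p.2 =
        E (Function.leftLim (fun s => Φ.flow s z) s) - E (Φ.flow s z) :=
    fun s hs => sum_contactPairs_jump hσ hσ2 htraj E hs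
  obtain ⟨-, htel⟩ := telescope hσ hσ2 htraj E hEd hEb hjump _ t ht rfl
  -- `transS` is the interval integral
  have htrans : transS σ N Φ ψ h δ t z =
      ∫ s in (0 : ℝ)..t, deriv (fun r => E (freeFlight (Torus.geometry (Fin 3)) r (Φ.flow s z))) 0 := by
    rw [intervalIntegral.integral_of_le ht, ← integral_Icc_eq_integral_Ioc]; rfl
  -- `realDiss = bregS + Σ jumps`
  have hfin : (collisionTimes (Torus.geometry (Fin 3)) (hsDiameter σ N) (fun s => Φ.flow s z) ∩ Ioc 0 t).Finite :=
    htraj.finite_collisionTimes_inter_of_subset_Icc Ioc_subset_Icc_self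
  have hsplit : realDiss σ N Φ ψ h δ t z = bregS σ N Φ ψ h δ t z +
      collisionPairSum (Torus.geometry (Fin 3)) (hsDiameter σ N) (fun s => Φ.flow s z) (Ioc 0 t) g := by
    unfold realDiss bregS HardSphereFlow.collisionPairSum
    rw [← collisionPairSum_add hfin]
    congr 1
    funext s i j
    simp only [hg, hE]
    split_ifs <;> ring
  rw [hsplit, htrans, ← htel]
  ring

/-! ## The transport term along a good orbit -/

/-- `|v_i(Φ_s z)| ≤ v_max(Φ_s z)`. -/
theorem norm_vel_le_vmax (w : Cfg N) (i : Fin (N + 1)) : ‖(w i).2‖ ≤ vmax N w :=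
  Finset.le_sup' (fun j => ‖(w j).2‖) (Finset.mem_univ i)

/-- `s ↦ (1 + v_max(Φ_s z))⁸` is integrable on the horizon along a good orbit (measurable and bounded). -/
theorem integrableOn_vmax8_flow (Φ : Flow σ N) {z : Cfg N} (hz : z ∈ Φ.good) (t : ℝ) :
    IntegrableOn (fun s => (1 + vmax N (Φ.flow s z)) ^ 8) (Icc 0 t) := by
  have hm : Measurable fun s => (1 + vmax N (Φ.flow s z)) ^ 8 :=
    (((PathwiseBudget.continuous_vmax N).measurable.comp (Reduction.measurable_flow_of_mem_good Φ hz)).const_add 1).pow_const 8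
  refine IntegrableOn.of_bound measure_Icc_lt_top hm.aestronglyMeasurable.restrict ((1 + Reduction.vR z) ^ 8) ?_
  refine ae_of_all _ fun s => ?_
  rw [Real.norm_eq_abs, abs_of_nonneg (pow_nonneg (add_nonneg zero_le_one (TailsVmax.vmax_nonneg N _)) 8)]
  exact pow_le_pow_left₀ (add_nonneg zero_le_one (TailsVmax.vmax_nonneg N _))
    (add_le_add le_rfl (PathwiseBudget.vmax_flow_le Φ hz s)) 8

/-- THE TRANSPORT TERM AGAINST THE TIME-INTEGRATED MAXIMAL SPEED: with the transport rate `K (N+1)^γ (1+V)⁸`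
(helper 11), `|transS| ≤ K (N+1)^{γ} ∫₀ᵗ (1 + v_max)⁸` on good orbits. -/
theorem abs_transS_le {γc K : ℝ}
    (hK : ∀ (w : Cfg N) (V : ℝ), (∀ i, ‖(w i).2‖ ≤ V) →
      |deriv (fun s => entS N ψ h δ (freeFlight (Torus.geometry (Fin 3)) s w)) 0| ≤ K * ((N : ℝ) + 1) ^ γc * (1 + V) ^ 8)
    (Φ : Flow σ N) {z : Cfg N} (hz : z ∈ Φ.good) (t : ℝ) :
    |transS σ N Φ ψ h δ t z| ≤ K * ((N : ℝ) + 1) ^ γc * vmaxInt σ N Φ t z := by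
  unfold transS vmaxInt
  have hg := (integrableOn_vmax8_flow Φ hz t).const_mul (K * ((N : ℝ) + 1) ^ γc)
  have h := norm_integral_le_of_norm_le
    (f := fun s => deriv (fun r => entS N ψ h δ (freeFlight (Torus.geometry (Fin 3)) r (Φ.flow s z))) 0)
    hg (ae_of_all _ fun s => ?_)
  · rw [Real.norm_eq_abs, integral_const_mul] at h
    exact h
  · rw [Real.norm_eq_abs]
    exact hK (Φ.flow s z) (vmax N (Φ.flow s z)) fun i => norm_vel_le_vmax _ i


/-! ## Eventual arithmetic in `N` -/

/-- `(N+1)^{-γ} → 0`, in the `((N : ℝ) + 1)` spelling of `AdmissibleKernel`. -/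
theorem eventually_support_small {γ : ℝ} (hγ : 0 < γ) : ∀ᶠ N : ℕ in atTop, ((N : ℝ) + 1) ^ (-γ) < 1 / 2 := by
  have hcast : Tendsto (fun N : ℕ => (N : ℝ) + 1) atTop atTop :=
    tendsto_atTop_add_const_right _ _ tendsto_natCast_atTop_atTop
  have h := (tendsto_rpow_neg_atTop hγ).comp hcast
  exact h.eventually (gt_mem_nhds (by norm_num))

/-- The margin closes: for `γ ≥ 0`, `p > 0` and constants `M, K`, eventually
`M + (K + 1) (N+1)^{γ + p/2} < (N+1)^{γ + p}`. -/
theorem eventually_margin {γ : ℝ} (hγ : 0 ≤ γ) (M K : ℝ) {p : ℝ} (hp : 0 < p) :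
    ∀ᶠ N : ℕ in atTop, M + (K + 1) * ((N + 1 : ℕ) : ℝ) ^ (γ + p / 2) < ((N + 1 : ℕ) : ℝ) ^ (γ + p) := by
  have hev : ∀ᶠ N : ℕ in atTop, max M 0 + max K 0 + 1 < ((N + 1 : ℕ) : ℝ) ^ (p / 2) :=
    (ContactBalance.TailsVmax.tendsto_natSucc_rpow_atTop (half_pos hp)).eventually_gt_atTop _
  filter_upwards [hev] with N hN
  have hpos : (0 : ℝ) < ((N + 1 : ℕ) : ℝ) := by positivity
  set X : ℝ := ((N + 1 : ℕ) : ℝ) ^ (γ + p / 2) with hX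
  have hX0 : 0 < X := Real.rpow_pos_of_pos hpos _
  have hX1 : 1 ≤ X := Real.one_le_rpow (by exact_mod_cast Nat.succ_le_succ (Nat.zero_le N)) (by linarith)
  have hsplit : ((N + 1 : ℕ) : ℝ) ^ (γ + p) = ((N + 1 : ℕ) : ℝ) ^ (p / 2) * X := by
    rw [hX, ← Real.rpow_add hpos]; congr 1; ring
  rw [hsplit]
  have h1 : M ≤ max M 0 * X := (le_max_left M 0).trans (le_mul_of_one_le_right (le_max_right _ _) hX1)
  have h2 : (K + 1) * X ≤ (max K 0 + 1) * X := mul_le_mul_of_nonneg_right (by linarith [le_max_left K 0]) hX0.le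
  have h3 : (max M 0 + max K 0 + 1) * X < ((N + 1 : ℕ) : ℝ) ^ (p / 2) * X := mul_lt_mul_of_pos_right hN hX0
  have e : (max M 0 + max K 0 + 1) * X = max M 0 * X + (max K 0 + 1) * X := by ring
  linarith

/-! ## The right side of the budget on the favourable event -/

/-- ON THE FAVOURABLE EVENT the right side of the budget is small: if `z` is good, the time-averaged exponential
moment is `≤ C_exp`, `∫₀ᵗ (1+v_max)⁸ ≤ (N+1)^{p/2}` and `bregS ≤ (N+1)^{γc+p/2}`, then
`S_N(Φ_0 z) − S_N(Φ_t z) + transS + bregS ≤ M + (K⁺ + 1) (N+1)^{γc + p/2}` with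
`M = 2 (|log (2πh²)^{-3/2}| + |log δ| + 3πh²) + 2π C_exp/(λ t)` and the transport constant `K` of helper 11. -/
theorem rhs_le_on_event {γc C' : ℝ} (hadm : AdmissibleKernel γc C' ψ) (hh : 0 < h) (hδ : 0 < δ) (hδ1 : δ ≤ 1)
    {K : ℝ} (hK : ∀ (w : Cfg N) (V : ℝ), (∀ i, ‖(w i).2‖ ≤ V) →
      |deriv (fun s => entS N ψ h δ (freeFlight (Torus.geometry (Fin 3)) s w)) 0| ≤ K * ((N : ℝ) + 1) ^ γc * (1 + V) ^ 8)
    (Φ : Flow σ N) {t : ℝ} (ht : 0 < t) {z : Cfg N} (hz : z ∈ Φ.good) {lam Cexp p : ℝ} (hlam : 0 < lam)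
    (hI : ∫ s in Icc 0 t, PastDamping.expMoment lam N (Φ.flow s z) ≤ Cexp)
    (hV : vmaxInt σ N Φ t z ≤ ((N + 1 : ℕ) : ℝ) ^ (p / 2))
    (hB : bregS σ N Φ ψ h δ t z ≤ ((N + 1 : ℕ) : ℝ) ^ (γc + p / 2)) :
    entS N ψ h δ (Φ.flow 0 z) - entS N ψ h δ (Φ.flow t z) + transS σ N Φ ψ h δ t z + bregS σ N Φ ψ h δ t z ≤
      (2 * (|Real.log ((2 * Real.pi * h ^ 2) ^ (-(3 : ℝ) / 2))| + |Real.log δ| + 3 * Real.pi * h ^ 2) +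
        2 * Real.pi * (Cexp / (lam * t))) + (max K 0 + 1) * ((N + 1 : ℕ) : ℝ) ^ (γc + p / 2) := by
  have hN : (0 : ℝ) < ((N + 1 : ℕ) : ℝ) := by positivity
  have hcast : ((N : ℝ) + 1) = ((N + 1 : ℕ) : ℝ) := by push_cast; ring
  -- the entropies: `|S_N| ≤ C₁ + π KE/(N+1)`, energy conserved and bounded by H2
  have hE : ∀ s, |entS N ψ h δ (Φ.flow s z)| ≤ (|Real.log ((2 * Real.pi * h ^ 2) ^ (-(3 : ℝ) / 2))| + |Real.log δ| +
      3 * Real.pi * h ^ 2) + Real.pi * (Cexp / (lam * t)) := by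
    intro s
    have h1 := abs_entS_le (Φ.flow s z) (hadm.2.1 N) (hadm.2.2.1 N) (hadm.1 N).continuous hh hδ hδ1
    have h2 := PastDamping.sum_sq_le_of_tails hlam Φ hz ht hI
    rw [Reduction.sum_sq_flow Φ hz s] at h1
    have h3 : ((N + 1 : ℕ) : ℝ)⁻¹ * ∑ j, ‖(z j).2‖ ^ 2 ≤ Cexp / (lam * t) := by
      rw [inv_mul_le_iff₀ hN]
      calc ∑ j, ‖(z j).2‖ ^ 2 ≤ ((N + 1 : ℕ) : ℝ) * Cexp / (lam * t) := h2
        _ = ((N + 1 : ℕ) : ℝ) * (Cexp / (lam * t)) := by ring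
    nlinarith [Real.pi_pos]
  have hE0 := hE 0
  have hEt := hE t
  -- the transport term
  have hK' : ∀ (w : Cfg N) (V : ℝ), (∀ i, ‖(w i).2‖ ≤ V) →
      |deriv (fun s => entS N ψ h δ (freeFlight (Torus.geometry (Fin 3)) s w)) 0| ≤ max K 0 * ((N : ℝ) + 1) ^ γc * (1 + V) ^ 8 := by
    intro w V hVw
    refine (hK w V hVw).trans (mul_le_mul_of_nonneg_right (mul_le_mul_of_nonneg_right (le_max_left K 0)
      (Real.rpow_nonneg (by positivity) _)) (pow_nonneg (add_nonneg zero_le_one (V_nonneg w hVw)) 8))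
  have hT := abs_transS_le (ψ := ψ) (h := h) (δ := δ) hK' Φ hz t
  rw [hcast] at hT
  have hKN : 0 ≤ max K 0 * ((N + 1 : ℕ) : ℝ) ^ γc := mul_nonneg (le_max_right K 0) (Real.rpow_nonneg hN.le _)
  have hT' : |transS σ N Φ ψ h δ t z| ≤ max K 0 * ((N + 1 : ℕ) : ℝ) ^ (γc + p / 2) := by
    calc |transS σ N Φ ψ h δ t z| ≤ max K 0 * ((N + 1 : ℕ) : ℝ) ^ γc * vmaxInt σ N Φ t z := hT
      _ ≤ max K 0 * ((N + 1 : ℕ) : ℝ) ^ γc * ((N + 1 : ℕ) : ℝ) ^ (p / 2) := mul_le_mul_of_nonneg_left hV hKN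
      _ = max K 0 * ((N + 1 : ℕ) : ℝ) ^ (γc + p / 2) := by rw [Real.rpow_add hN]; ring
  -- assemble
  have a1 := (le_abs_self _).trans hE0
  have a3 := (le_abs_self _).trans hT'
  have hEt' : -entS N ψ h δ (Φ.flow t z) ≤ (|Real.log ((2 * Real.pi * h ^ 2) ^ (-(3 : ℝ) / 2))| + |Real.log δ| +
      3 * Real.pi * h ^ 2) + Real.pi * (Cexp / (lam * t)) := (neg_le_abs _).trans hEt
  linarith


end EntropyBudget

open EntropyBudget in
/-- **THE ENTROPY BUDGET MODULO THE BREGMAN SUM** (`stub_entropyBudget` with its mechanism (iv) — the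
smallness of the Bregman sum — taken as an explicit hypothesis, written inline in the vocabulary of the line):
for nice profiles, `0 < σ < 1/2`, a cell family admissible at `γc ∈ (1/6, 1/3)`, `(h, δ) ∈ (0,1)²`, every flow
family and `t > 0` with H2, few collisions, and `∀ p > 0, P_N{(N+1)^{γc+p} < bregS} → 0`:
`BudgetDecompOn` — w.h.p. the EXACT identity `realDiss = S_N(Φ_0 z) − S_N(Φ_t z) + transS + bregS` holds and its
right side is `≤ (N+1)^{γc+p}`. (The identity holds on the good set, which carries the local Gibbs law; the
entropies are `O_P(1)` and the transport term is `O_P((N+1)^{γc+p/2})` by H2; the margin closes eventually.) -/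
theorem budgetDecompOn_of_bregSmall : ∀ (a₀ θ₀ : T3 → ℝ) (u₀ : T3 → V3), NiceProfiles a₀ θ₀ u₀ →
    ∀ σ : ℝ, 0 < σ → σ < 2⁻¹ →
    ∀ (γc C' : ℝ) (ψ : ℕ → T3 → ℝ), 1 / 6 < γc → γc < 1 / 3 → AdmissibleKernel γc C' ψ →
      ∀ h δ : ℝ, 0 < h → h < 1 → 0 < δ → δ < 1 → ∀ (Φ : Flows σ) (t : ℝ), 0 < t →
        TailsOn σ a₀ θ₀ u₀ Φ t → FewCollisionsOn σ a₀ θ₀ u₀ Φ t →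
        (∀ p : ℝ, 0 < p → Tendsto (fun N : ℕ => localGibbsLaw σ a₀ u₀ θ₀ N (Φ N)
          {z | ((N + 1 : ℕ) : ℝ) ^ (γc + p) < bregS σ N (Φ N) ψ h δ t z}) atTop (𝓝 0)) →
        BudgetDecompOn σ a₀ θ₀ u₀ Φ ψ γc h δ t := by
  intro a₀ θ₀ u₀ hnice σ hσ hσ2 γc C' ψ hγ1 _hγ2 hadm h δ hh _hh1 hδ hδ1 Φ t ht hT _hfew hBreg p hp
  have hγ0 : 0 < γc := by linarith
  have hvm := stub_tailsVmax a₀ θ₀ u₀ hnice σ hσ hσ2 Φ t ht hT (p / 2) (half_pos hp)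
  obtain ⟨lam, Cexp, hlam, hH2⟩ := hT
  obtain ⟨K, hK⟩ := transport_rate (ψ := ψ) (h := h) (δ := δ) hadm hh hδ hδ1.le
  have hB := hBreg (p / 2) (half_pos hp)
  set M : ℝ := 2 * (|Real.log ((2 * Real.pi * h ^ 2) ^ (-(3 : ℝ) / 2))| + |Real.log δ| + 3 * Real.pi * h ^ 2) +
    2 * Real.pi * (Cexp / (lam * t)) with hM
  -- the four exceptional events
  let EH : (N : ℕ) → Set (Cfg N) := fun N =>
    {z | Cexp < ∫ s in Icc 0 t, ∫ y, Real.exp (lam * ‖y.2‖ ^ 2) ∂(empiricalMeasure ((Φ N).flow s z))}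
  let EV : (N : ℕ) → Set (Cfg N) := fun N => {z | ((N + 1 : ℕ) : ℝ) ^ (p / 2) < vmaxInt σ N (Φ N) t z}
  let EB : (N : ℕ) → Set (Cfg N) := fun N => {z | ((N + 1 : ℕ) : ℝ) ^ (γc + p / 2) < bregS σ N (Φ N) ψ h δ t z}
  -- deterministic inclusion, eventually in `N`
  have hincl : ∀ᶠ N : ℕ in atTop,
      {z | realDiss σ N (Φ N) ψ h δ t z ≠
          entS N ψ h δ ((Φ N).flow 0 z) - entS N ψ h δ ((Φ N).flow t z) +
            transS σ N (Φ N) ψ h δ t z + bregS σ N (Φ N) ψ h δ t z ∨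
        ((N + 1 : ℕ) : ℝ) ^ (γc + p) <
          entS N ψ h δ ((Φ N).flow 0 z) - entS N ψ h δ ((Φ N).flow t z) +
            transS σ N (Φ N) ψ h δ t z + bregS σ N (Φ N) ψ h δ t z} ⊆
        (((Φ N).goodᶜ ∪ EH N) ∪ EV N) ∪ EB N := by
    filter_upwards [eventually_support_small hγ0, eventually_margin hγ0.le M (max K 0) hp] with N hN1 hN2 z hz
    by_contra hnot
    simp only [mem_union, mem_compl_iff, mem_setOf_eq, not_or, not_lt, not_not, EH, EV, EB] at hnot
    obtain ⟨⟨⟨hzg, hzH⟩, hzV⟩, hzB⟩ := hnot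
    rw [PastDamping.tails_integral_eq] at hzH
    have hid := budget_identity hadm hh hδ hδ1.le hσ hσ2 (Φ N) ht.le hzg
    have hrhs := rhs_le_on_event (p := p) hadm hh hδ hδ1.le (hK N hN1) (Φ N) ht hzg hlam hzH hzV hzB
    simp only [mem_setOf_eq] at hz
    rcases hz with hne | hlt
    · exact hne hid
    · rw [← hM] at hrhs
      linarith
  -- measure bound, eventually in `N`
  have hle : ∀ᶠ N : ℕ in atTop, localGibbsLaw σ a₀ u₀ θ₀ N (Φ N)
      {z | realDiss σ N (Φ N) ψ h δ t z ≠
          entS N ψ h δ ((Φ N).flow 0 z) - entS N ψ h δ ((Φ N).flow t z) +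
            transS σ N (Φ N) ψ h δ t z + bregS σ N (Φ N) ψ h δ t z ∨
        ((N + 1 : ℕ) : ℝ) ^ (γc + p) <
          entS N ψ h δ ((Φ N).flow 0 z) - entS N ψ h δ ((Φ N).flow t z) +
            transS σ N (Φ N) ψ h δ t z + bregS σ N (Φ N) ψ h δ t z} ≤
      localGibbsLaw σ a₀ u₀ θ₀ N (Φ N) (EH N) + localGibbsLaw σ a₀ u₀ θ₀ N (Φ N) (EV N) +
        localGibbsLaw σ a₀ u₀ θ₀ N (Φ N) (EB N) := by
    filter_upwards [hincl] with N hN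
    have hgood : localGibbsLaw σ a₀ u₀ θ₀ N (Φ N) (Φ N).goodᶜ = 0 :=
      localGibbsLaw_absolutelyContinuous σ a₀ u₀ θ₀ N (Φ N) (Φ N).measure_compl_good
    calc localGibbsLaw σ a₀ u₀ θ₀ N (Φ N) _ ≤ localGibbsLaw σ a₀ u₀ θ₀ N (Φ N) ((((Φ N).goodᶜ ∪ EH N) ∪ EV N) ∪ EB N) :=
          measure_mono hN
      _ ≤ localGibbsLaw σ a₀ u₀ θ₀ N (Φ N) (((Φ N).goodᶜ ∪ EH N) ∪ EV N) + localGibbsLaw σ a₀ u₀ θ₀ N (Φ N) (EB N) :=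
          measure_union_le _ _
      _ ≤ localGibbsLaw σ a₀ u₀ θ₀ N (Φ N) ((Φ N).goodᶜ ∪ EH N) + localGibbsLaw σ a₀ u₀ θ₀ N (Φ N) (EV N) +
            localGibbsLaw σ a₀ u₀ θ₀ N (Φ N) (EB N) := add_le_add (measure_union_le _ _) le_rfl
      _ ≤ localGibbsLaw σ a₀ u₀ θ₀ N (Φ N) (Φ N).goodᶜ + localGibbsLaw σ a₀ u₀ θ₀ N (Φ N) (EH N) +
            localGibbsLaw σ a₀ u₀ θ₀ N (Φ N) (EV N) + localGibbsLaw σ a₀ u₀ θ₀ N (Φ N) (EB N) :=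
          add_le_add (add_le_add (measure_union_le _ _) le_rfl) le_rfl
      _ = _ := by rw [hgood, zero_add]
  have hsum : Tendsto (fun N : ℕ => localGibbsLaw σ a₀ u₀ θ₀ N (Φ N) (EH N) + localGibbsLaw σ a₀ u₀ θ₀ N (Φ N) (EV N) +
      localGibbsLaw σ a₀ u₀ θ₀ N (Φ N) (EB N)) atTop (𝓝 0) := by
    have h3 := (hH2.add hvm).add hB
    rw [add_zero, add_zero] at h3
    exact h3
  exact tendsto_of_tendsto_of_tendsto_of_le_of_le' tendsto_const_nhds hsum (Eventually.of_forall fun N => bot_le) hle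

/-- Registered anchor of this file (`--supports stmt-AtomisticToContinuum-14868`): the exact telescoping identity
of `stub_entropyBudget` on good orbits. -/
theorem bhEntropyBudget_main_anchor : ∀ (γc C' : ℝ) (ψ : ℕ → T3 → ℝ), AdmissibleKernel γc C' ψ → ∀ (h δ : ℝ), 0 < h → 0 < δ → δ ≤ 1 →
    ∀ (σ : ℝ), 0 < σ → σ < 2⁻¹ → ∀ (N : ℕ) (Φ : Flow σ N) (t : ℝ), 0 ≤ t → ∀ z ∈ Φ.good, realDiss σ N Φ ψ h δ t z = entS N ψ h δ (Φ.flow 0 z) -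
    entS N ψ h δ (Φ.flow t z) + transS σ N Φ ψ h δ t z + bregS σ N Φ ψ h δ t z :=
  fun _ _ _ hadm _ _ hh hδ hδ1 _ hσ hσ2 _ Φ _ ht _ hz => EntropyBudget.budget_identity hadm hh hδ hδ1 hσ hσ2 Φ ht hz

end

end Summit.AtomisticToContinuum.HydrodynamicLimit.Theorems.BlockHDissipation
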